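import Literature.MathematicalPhysics.QuantumFieldTheory.U1GinibreComparison
import HarnessLib

/-!
# `U(1)` lattice gauge theory: phase flows, Haar integration by parts and the linking
(Gauss-law) Ward identity — on finite tori and for infinite-volume limit states

Wilson-action `U(1)` lattice gauge theory in the tree's conventions: gauge group `Circle`,
defining representation `u1Rep`, torus states `wilsonMeasure u1Rep β` / expectations
`wilsonExpectation u1Rep β` on `GaugeConfig d L Circle` (`ConstructiveQFTWave0`), and their
infinite-volume limit points `infiniteVolumeLimitPoints u1Rep β` on `LGConfig d Circle`
(`LatticeGaugeDLR`), read through the periodic lift `torusLift` / `toTorusObservable`.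

## Contents

* **Phase flows on the torus.** For an integer charge vector `c : Edge d L → ℤ` the pure-phase
  configuration `expConfig c t = (e ↦ e^{i c(e) t})` and the flow `phaseFlow c t U = expConfig c t · U`
  (the flow of the vector field `X_c = ∑_e c(e) ∂/∂θ_e`); plaquette charges `plaqCharge`
  (`X_c θ_p`), `plaquetteHolonomy_phaseFlow` (`(φ_t U)_p = e^{i n_p t} U_p`), the flow derivative
  of the Wilson action `actionFlowDeriv c U = ∑_p n_p sin θ_p` (`hasDerivAt_wilsonAction_phaseFlow`).
* **Haar integration by parts** (`integral_flowDeriv_eq_zero`): if `t ↦ H(φ_t U)` has derivative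
  `H'(φ_t U)` with `H, H'` continuous, then `∫ H' dHaar = 0` — the product Haar measure is invariant
  under the flow (`integral_comp_phaseFlow`, literally `integral_mul_left_eq_self`), so
  `t ↦ ∫ H(φ_t U)` is constant, and it may be differentiated under the integral sign
  (`hasDerivAt_integral_of_dominated_loc_of_deriv_le`; the configuration torus is compact).
* **The `U(1)` Ward identity on a finite torus** (`u1_torus_ward_identity`): for every `β`, every
  `c` and every pair `(F, XF)` with `d/dt F(φ_t U) = XF(φ_t U)`:
  `⟨XF⟩_β = β ⟨F · X_c S⟩_β` (integration by parts against `e^{-β S}`).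
* **Inversion symmetry** (`wilsonExpectation_u1_comp_inv`, `wilsonExpectation_u1_eq_zero_of_odd`,
  `wilsonExpectation_u1_plaquette_im`): the torus state is invariant under `U ↦ U⁻¹`, so odd
  observables such as `sin θ_p` have zero expectation.
* **The `ℤ^d` side and periodisation.** Flows `zdPhaseFlow` on `LGConfig d Circle`, the indicator
  charge `indicatorCharge V` of a finite bond set `V`, the charge `torusCharge L V` it induces on a
  torus, and the localisation lemmas (`torusCharge_torusEdge`, `toTorusObservable_phaseFlow`): a
  cylinder observable based in a cube sees the periodised flow as the plain flow once the torus is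
  large; the abelian bookkeeping `plaquette_zdPhaseFlow`, `line_zdExpConfig`,
  `rectangle_zdPhaseFlow` with the charges `zdPlaqCharge`, `lineCharge`, `rectCharge` (the last is
  the signed intersection number of a rectangular loop with `V`); the **sum transfer**
  `sum_plaqCharge_torusCharge` / `actionFlowDeriv_torusCharge` identifying the torus action
  derivative with a fixed finite `ℤ^d` plaquette sum (plaquettes away from `V` carry no induced
  charge: `exists_plaqProj_of_plaqCharge_ne_zero`).
* **Observables** `u1LoopRe` / `u1LoopIm` (`cos θ(C)`, `sin θ(C)` of a rectangular loop `C`) and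
  `u1PlaqIm` (`sin θ_p`; `β sin θ_p` is the field strength of Wilson's `U(1)` model,
  Fröhlich–Spencer 1982 (2.89)), with continuity, cylinder property, bounds, gauge invariance
  (`rectangle_gaugeTransformZd`), and the bridge `walkHolonomy_rectWalk_eq_rectangle` to the
  tree's walk holonomies (`rectExpectation`).
* **The linking (Gauss-law) Ward identity**, torus form `u1_torus_linking_ward_identity` and,
  passing to the limit along the defining tori, for EVERY infinite-volume limit point `μ`
  (`u1_linking_ward_identity`):
  `ℓ(C,V) · E_μ[cos θ(C)] = β ∑_p n_p(V) · E_μ[sin θ(C) sin θ_p]`,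
  together with `E_μ[sin θ_p] = 0` (`integral_u1PlaqIm_eq_zero`). For `V` the set of time-like
  bonds crossing a finite dual 3-chain in `d = 4`, the charges `n_p(V)` live on the plaquettes dual
  to its boundary 2-sphere `∂V` and `ℓ(C,V)` is the linking number of `C` with `∂V`: the identity
  is the lattice Gauss law "electric flux through a sphere linking the Wilson line = charge", in
  expectation.

## Sources

Standard material: integration by parts / Schwinger–Dyson (Ward) identities for lattice gauge
theories with compact gauge group, here for `U(1)` where the one-parameter subgroups
`θ_e ↦ θ_e + t` make it an honest integration by parts on a torus; the lattice `U(1)` Gauss law.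
All declarations are tagged [folklore]. The Wilson-model field strength `iβ sin(dθ_p)` is
Fröhlich–Spencer, Comm. Math. Phys. 83 (1982) 411, (2.89) p. 433 (`FrohlichSpencerCMP1982`).

## Design choices

* Charges are arbitrary functions `c : edges → ℤ`; nothing requires `V` to be a dual chain — the
  "boundary" structure is encoded in where `zdPlaqCharge (indicatorCharge V)` is non-zero.
* The flow is left multiplication by a pure-phase configuration, so Haar invariance is Mathlib's
  `integral_mul_left_eq_self` for the product group `Edge d L → Circle`
  (`Measure.pi.isMulLeftInvariant`), and inversion symmetry is `integral_inv_eq_self`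
  (`Measure.pi.isInvInvariant`, with the tree's `haarProbability.instIsInvInvariant`).
* Regularity hypotheses are "continuous" throughout: on the compact configuration torus this gives
  boundedness and integrability for free (`exists_bound_of_continuous_torus`,
  `integrable_u1TorusHaar_of_continuous`).
* General dimension `d`; tori of size `L + 1` (so `[NeZero (L+1)]` is automatic, as in
  `IsInfiniteVolumeLimitAlong`); the periodisation lemmas carry explicit size hypotheses
  (`2n ≤ L`, `2(n+2) ≤ L`) and the `ℤ^d` plaquette sums run over all plaquettes based in a cube
  `{-(n+1),…,n+1}^d` (`box d (n+1) ×ˢ univ`), the charges vanishing elsewhere.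
* Loops are the rectangles of `Sweep1` (`ZdGaugeConfig.rectangle`, bonds `AreaLaw.loopEdges`);
  `walkHolonomy_rectWalk_eq_rectangle` connects them to `WilsonLoops.rectWalk`.

## Not here

The barrier built on this identity — the bound `m ≤ 8c` on support-linear clustering rates of
`U(1)₄` states with perimeter constant `c` — is `Literature/Barriers/QuantumFields/U1GaussLawRateBound.lean`.
Non-rectangular loops, non-abelian groups and the Villain action are not treated.
-/

noncomputable section

open MeasureTheory Filter Topology
open Literature.Probability.LatticeModels Literature.MathematicalPhysics.QuantumLattice

namespace Literature.MathematicalPhysics.QuantumFieldTheory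

open AreaLaw

variable {d L : ℕ}

/-! ### Rotated unit complex numbers -/

/-- `Re (e^{is} z) = cos s · Re z − sin s · Im z`. [folklore] -/
theorem coe_exp_mul_re (s : ℝ) (z : Circle) :
    ((Circle.exp s * z : Circle) : ℂ).re = Real.cos s * (z : ℂ).re - Real.sin s * (z : ℂ).im := by
  rw [Circle.coe_mul, Circle.coe_exp, Complex.mul_re, Complex.exp_ofReal_mul_I_re,
    Complex.exp_ofReal_mul_I_im]

/-- `Im (e^{is} z) = cos s · Im z + sin s · Re z`. [folklore] -/
theorem coe_exp_mul_im (s : ℝ) (z : Circle) :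
    ((Circle.exp s * z : Circle) : ℂ).im = Real.cos s * (z : ℂ).im + Real.sin s * (z : ℂ).re := by
  rw [Circle.coe_mul, Circle.coe_exp, Complex.mul_im, Complex.exp_ofReal_mul_I_re,
    Complex.exp_ofReal_mul_I_im, add_comm]

/-- `d/dt Re (e^{iat} z) = -a · Im (e^{iat} z)`. [folklore] -/
theorem hasDerivAt_coe_exp_mul_re (a : ℝ) (z : Circle) (t : ℝ) :
    HasDerivAt (fun s : ℝ => ((Circle.exp (a * s) * z : Circle) : ℂ).re)
      (-a * ((Circle.exp (a * t) * z : Circle) : ℂ).im) t := by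
  simp_rw [coe_exp_mul_re, coe_exp_mul_im]
  have h1 : HasDerivAt (fun s : ℝ => a * s) a t := by
    simpa using (hasDerivAt_id t).const_mul a
  refine (((h1.cos).mul_const ((z : ℂ).re)).sub ((h1.sin).mul_const ((z : ℂ).im))).congr_deriv ?_
  ring

/-- `d/dt Im (e^{iat} z) = a · Re (e^{iat} z)`. [folklore] -/
theorem hasDerivAt_coe_exp_mul_im (a : ℝ) (z : Circle) (t : ℝ) :
    HasDerivAt (fun s : ℝ => ((Circle.exp (a * s) * z : Circle) : ℂ).im)
      (a * ((Circle.exp (a * t) * z : Circle) : ℂ).re) t := by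
  simp_rw [coe_exp_mul_re, coe_exp_mul_im]
  have h1 : HasDerivAt (fun s : ℝ => a * s) a t := by
    simpa using (hasDerivAt_id t).const_mul a
  refine (((h1.cos).mul_const ((z : ℂ).im)).add ((h1.sin).mul_const ((z : ℂ).re))).congr_deriv ?_
  ring

/-! ### Phase flows on `U(1)` torus configurations -/

/-- The configuration `e ↦ e^{i c(e) t}` of pure phases with integer charges `c`. [folklore] -/
def expConfig (c : Edge d L → ℤ) (t : ℝ) : GaugeConfig d L Circle := fun e => Circle.exp (c e * t)

/-- The phase flow `U ↦ (e ↦ e^{i c(e) t} U_e)` generated by the vector field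
`X_c = ∑_e c(e) ∂/∂θ_e` on `U(1)` torus configurations. [folklore] -/
def phaseFlow (c : Edge d L → ℤ) (t : ℝ) (U : GaugeConfig d L Circle) : GaugeConfig d L Circle :=
  expConfig c t * U

/-- `phaseFlow` edgewise. [folklore] -/
@[simp] theorem phaseFlow_apply (c : Edge d L → ℤ) (t : ℝ) (U : GaugeConfig d L Circle) (e : Edge d L) :
    phaseFlow c t U e = Circle.exp (c e * t) * U e := rfl

/-- The flow at time `0` is the identity. [folklore] -/
@[simp] theorem phaseFlow_zero (c : Edge d L → ℤ) (U : GaugeConfig d L Circle) : phaseFlow c 0 U = U := by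
  funext e; simp

/-- The flow is continuous in the configuration. [folklore] -/
theorem continuous_phaseFlow (c : Edge d L → ℤ) (t : ℝ) : Continuous (phaseFlow c t) :=
  continuous_const.mul continuous_id

/-- The charge of the plaquette `(x; i, j)` under the vector field `X_c`:
`X_c θ_p = c(x,i) + c(x+eᵢ,j) − c(x+eⱼ,i) − c(x,j)`. [folklore] -/
def plaqCharge (c : Edge d L → ℤ) (x : Site d L) (i j : Fin d) : ℤ :=
  c (x, i) + c (x.shift i, j) - c (x.shift j, i) - c (x, j)

/-- The plaquette holonomy of the pure-phase configuration. [folklore] -/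
theorem plaquetteHolonomy_expConfig (c : Edge d L → ℤ) (t : ℝ) (x : Site d L) (i j : Fin d) :
    plaquetteHolonomy (expConfig c t) x i j = Circle.exp (plaqCharge c x i j * t) := by
  simp only [plaquetteHolonomy, expConfig, plaqCharge, ← Circle.exp_neg, ← Circle.exp_add]
  congr 1
  push_cast
  ring

/-- Plaquette holonomies rotate under the flow by their charge: `(φ_t U)_p = e^{i n_p t} U_p`.
[folklore] -/
theorem plaquetteHolonomy_phaseFlow (c : Edge d L → ℤ) (t : ℝ) (U : GaugeConfig d L Circle)
    (x : Site d L) (i j : Fin d) :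
    plaquetteHolonomy (phaseFlow c t U) x i j =
      Circle.exp (plaqCharge c x i j * t) * plaquetteHolonomy U x i j := by
  rw [phaseFlow, ← plaquetteHolonomy_expConfig]
  exact (u1PlaqChar x i j).map_mul _ _

/-- The derivative of the `U(1)` Wilson action along the flow, `X_c S = ∑_p n_p Im U_p`.
[folklore] -/
def actionFlowDeriv [NeZero L] (c : Edge d L → ℤ) (U : GaugeConfig d L Circle) : ℝ :=
  ∑ p : Plaquette d L,
    (plaqCharge c p.1 p.2.1.1 p.2.1.2 : ℝ) * ((plaquetteHolonomy U p.1 p.2.1.1 p.2.1.2 : Circle) : ℂ).im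

/-- The `U(1)` Wilson action is `∑_p (1 − Re U_p)`. [folklore] -/
theorem wilsonAction_u1_eq [NeZero L] (U : GaugeConfig d L Circle) :
    wilsonAction u1Rep U =
      ∑ p : Plaquette d L, (1 - ((plaquetteHolonomy U p.1 p.2.1.1 p.2.1.2 : Circle) : ℂ).re) := by
  simp [wilsonAction]

/-- `d/dt S(φ_t U) = (X_c S)(φ_t U)`. [folklore] -/
theorem hasDerivAt_wilsonAction_phaseFlow [NeZero L] (c : Edge d L → ℤ) (U : GaugeConfig d L Circle)
    (t : ℝ) :
    HasDerivAt (fun s => wilsonAction u1Rep (phaseFlow c s U)) (actionFlowDeriv c (phaseFlow c t U)) t := by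
  simp only [wilsonAction_u1_eq, actionFlowDeriv, plaquetteHolonomy_phaseFlow]
  refine HasDerivAt.fun_sum fun p _ => ?_
  have h := hasDerivAt_coe_exp_mul_re (plaqCharge c p.1 p.2.1.1 p.2.1.2 : ℝ)
    (plaquetteHolonomy U p.1 p.2.1.1 p.2.1.2) t
  refine (h.const_sub 1).congr_deriv ?_
  ring

/-- The flow is continuous; the action derivative is continuous. [folklore] -/
theorem continuous_actionFlowDeriv [NeZero L] (c : Edge d L → ℤ) :
    Continuous (actionFlowDeriv (d := d) (L := L) c) := by
  unfold actionFlowDeriv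
  refine continuous_finsetSum _ fun p _ => continuous_const.mul ?_
  exact Complex.continuous_im.comp (continuous_subtype_val.comp (u1PlaqChar p.1 p.2.1.1 p.2.1.2).continuous)

/-! ### Haar integration by parts on the configuration torus -/

section Torus

variable [NeZero L]

/-- Haar measure is invariant under the phase flow (left translation by `expConfig c t`).
[folklore] -/
theorem integral_comp_phaseFlow (c : Edge d L → ℤ) (t : ℝ) (H : GaugeConfig d L Circle → ℝ) :
    ∫ U, H (phaseFlow c t U) ∂(Measure.pi fun _ : Edge d L => haarProbability Circle) = ∫ U, H U ∂(Measure.pi fun _ : Edge d L => haarProbability Circle) := by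
  exact integral_mul_left_eq_self H (expConfig c t)

omit [NeZero L] in
/-- A continuous real function on the (compact) configuration torus is bounded. [folklore] -/
theorem exists_bound_of_continuous_torus {H : GaugeConfig d L Circle → ℝ} (hH : Continuous H) :
    ∃ M, ∀ U, ‖H U‖ ≤ M := by
  obtain ⟨M, hM⟩ := isCompact_univ.exists_bound_of_continuousOn hH.continuousOn
  exact ⟨M, fun U => hM U (Set.mem_univ _)⟩

/-- A continuous real function on the configuration torus is Haar integrable. [folklore] -/
theorem integrable_u1TorusHaar_of_continuous {H : GaugeConfig d L Circle → ℝ} (hH : Continuous H) :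
    Integrable H (Measure.pi fun _ : Edge d L => haarProbability Circle) :=
  hH.integrable_of_hasCompactSupport (HasCompactSupport.of_compactSpace H)

/-- **Haar integration by parts along a phase flow.** If `t ↦ H(φ_t U)` has derivative
`H'(φ_t U)` for all `U, t`, with `H, H'` continuous, then `∫ H' dHaar = 0`: the function
`t ↦ ∫ H(φ_t U) dHaar(U)` is constant by invariance of Haar measure, and may be differentiated
under the integral sign (dominated convergence on the compact configuration space). [folklore] -/
theorem integral_flowDeriv_eq_zero (c : Edge d L → ℤ) {H H' : GaugeConfig d L Circle → ℝ}
    (hH : Continuous H) (hH' : Continuous H')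
    (hderiv : ∀ U t, HasDerivAt (fun s => H (phaseFlow c s U)) (H' (phaseFlow c t U)) t) :
    ∫ U, H' U ∂(Measure.pi fun _ : Edge d L => haarProbability Circle) = 0 := by
  obtain ⟨M, hM⟩ := exists_bound_of_continuous_torus hH'
  have key := hasDerivAt_integral_of_dominated_loc_of_deriv_le (μ := Measure.pi fun _ : Edge d L => haarProbability Circle)
    (F := fun t U => H (phaseFlow c t U)) (F' := fun t U => H' (phaseFlow c t U)) (x₀ := (0 : ℝ))
    (bound := fun _ => M) (s := Set.univ) Filter.univ_mem
    (Filter.Eventually.of_forall fun t =>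
      (hH.comp (continuous_phaseFlow c t)).aestronglyMeasurable)
    (integrable_u1TorusHaar_of_continuous (hH.comp (continuous_phaseFlow c 0)))
    ((hH'.comp (continuous_phaseFlow c 0)).aestronglyMeasurable)
    (ae_of_all _ fun U t _ => hM _) (integrable_const M)
    (ae_of_all _ fun U t _ => hderiv U t)
  have h2 : HasDerivAt (fun t : ℝ => ∫ U, H (phaseFlow c t U) ∂(Measure.pi fun _ : Edge d L => haarProbability Circle)) 0 0 := by
    simp_rw [integral_comp_phaseFlow]
    exact hasDerivAt_const _ _
  have h3 := key.2.unique h2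
  simpa using h3

/-! ### The `U(1)` Ward identity on the torus -/

/-- **The `U(1)` Ward identity (Schwinger–Dyson / lattice Gauss law) on a finite torus.** For the
Wilson-action `U(1)` theory at any `β` and any charge vector `c`, if `t ↦ F(φ_t U)` has
derivative `(XF)(φ_t U)` (`F`, `XF` continuous), then `⟨XF⟩_β = β ⟨F · X_c S⟩_β` with
`X_c S = ∑_p n_p Im U_p`: integration by parts for Haar measure against the weight `e^{-β S}`.
[folklore] -/
theorem u1_torus_ward_identity (c : Edge d L → ℤ) (β : ℝ) {F XF : GaugeConfig d L Circle → ℝ}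
    (hF : Continuous F) (hXF : Continuous XF)
    (hderiv : ∀ U t, HasDerivAt (fun s => F (phaseFlow c s U)) (XF (phaseFlow c t U)) t) :
    wilsonExpectation u1Rep β XF =
      β * wilsonExpectation u1Rep β (fun U => F U * actionFlowDeriv c U) := by
  have hSc : Continuous fun U : GaugeConfig d L Circle => wilsonAction u1Rep U :=
    continuous_wilsonAction u1Rep continuous_u1Rep
  have hXS := continuous_actionFlowDeriv (d := d) (L := L) c
  have hwc : Continuous fun U : GaugeConfig d L Circle => Real.exp (-β * wilsonAction u1Rep U) :=
    Real.continuous_exp.comp (continuous_const.mul hSc)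
  have hHc : Continuous fun U : GaugeConfig d L Circle =>
      F U * Real.exp (-β * wilsonAction u1Rep U) := hF.mul hwc
  have hH'c : Continuous fun U : GaugeConfig d L Circle =>
      XF U * Real.exp (-β * wilsonAction u1Rep U) +
        F U * (Real.exp (-β * wilsonAction u1Rep U) * (-β * actionFlowDeriv c U)) :=
    (hXF.mul hwc).add (hF.mul (hwc.mul (continuous_const.mul hXS)))
  have hder : ∀ U t, HasDerivAt
      (fun s => F (phaseFlow c s U) * Real.exp (-β * wilsonAction u1Rep (phaseFlow c s U)))
      (XF (phaseFlow c t U) * Real.exp (-β * wilsonAction u1Rep (phaseFlow c t U)) +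
        F (phaseFlow c t U) * (Real.exp (-β * wilsonAction u1Rep (phaseFlow c t U)) *
          (-β * actionFlowDeriv c (phaseFlow c t U)))) t := fun U t =>
    (hderiv U t).mul ((hasDerivAt_wilsonAction_phaseFlow c U t).const_mul (-β)).exp
  have h0 := integral_flowDeriv_eq_zero c
    (H := fun U => F U * Real.exp (-β * wilsonAction u1Rep U))
    (H' := fun U => XF U * Real.exp (-β * wilsonAction u1Rep U) +
      F U * (Real.exp (-β * wilsonAction u1Rep U) * (-β * actionFlowDeriv c U))) hHc hH'c hder
  -- split the integral
  have hi1 : Integrable (fun U => XF U * Real.exp (-β * wilsonAction u1Rep U))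
      (Measure.pi fun _ : Edge d L => haarProbability Circle) :=
    integrable_u1TorusHaar_of_continuous (hXF.mul hwc)
  have hi2 : Integrable
      (fun U => F U * (Real.exp (-β * wilsonAction u1Rep U) * (-β * actionFlowDeriv c U)))
      (Measure.pi fun _ : Edge d L => haarProbability Circle) :=
    integrable_u1TorusHaar_of_continuous (hF.mul (hwc.mul (continuous_const.mul hXS)))
  have h0' : ∫ U, XF U * Real.exp (-β * wilsonAction u1Rep U)
        ∂(Measure.pi fun _ : Edge d L => haarProbability Circle) +
      ∫ U, F U * (Real.exp (-β * wilsonAction u1Rep U) * (-β * actionFlowDeriv c U))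
        ∂(Measure.pi fun _ : Edge d L => haarProbability Circle) = 0 := by
    rw [← integral_add hi1 hi2]
    exact h0
  have h3 : ∫ U, F U * (Real.exp (-β * wilsonAction u1Rep U) * (-β * actionFlowDeriv c U))
        ∂(Measure.pi fun _ : Edge d L => haarProbability Circle) =
      -β * ∫ U, F U * actionFlowDeriv c U * Real.exp (-β * wilsonAction u1Rep U)
        ∂(Measure.pi fun _ : Edge d L => haarProbability Circle) := by
    rw [← integral_const_mul]
    refine integral_congr_ae (ae_of_all _ fun U => ?_)
    ring
  rw [h3] at h0'
  have h4 : ∫ U, XF U * Real.exp (-β * wilsonAction u1Rep U)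
        ∂(Measure.pi fun _ : Edge d L => haarProbability Circle) =
      β * ∫ U, F U * actionFlowDeriv c U * Real.exp (-β * wilsonAction u1Rep U)
        ∂(Measure.pi fun _ : Edge d L => haarProbability Circle) := by linarith
  rw [wilsonExpectation_eq_div_integral u1Rep continuous_u1Rep,
    wilsonExpectation_eq_div_integral u1Rep continuous_u1Rep]
  rw [h4, mul_div_assoc]

/-! ### Inversion symmetry -/

omit [NeZero L] in
/-- Plaquette holonomies of the inverted configuration (abelian group). [folklore] -/
theorem plaquetteHolonomy_inv (U : GaugeConfig d L Circle) (x : Site d L) (i j : Fin d) :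
    plaquetteHolonomy U⁻¹ x i j = (plaquetteHolonomy U x i j)⁻¹ :=
  ((u1PlaqChar x i j).map_inv U)

/-- The `U(1)` Wilson action is invariant under `U ↦ U⁻¹` (`Re z̄ = Re z`). [folklore] -/
theorem wilsonAction_u1_inv (U : GaugeConfig d L Circle) :
    wilsonAction u1Rep U⁻¹ = wilsonAction u1Rep U := by
  simp only [wilsonAction_u1_eq, plaquetteHolonomy_inv, Circle.coe_inv_eq_conj, Complex.conj_re]

/-- **Inversion symmetry of the torus `U(1)` state**: `⟨F ∘ inv⟩_β = ⟨F⟩_β` (Haar measure is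
inversion invariant and the action is even). [folklore] -/
theorem wilsonExpectation_u1_comp_inv (β : ℝ) (F : GaugeConfig d L Circle → ℝ) :
    wilsonExpectation u1Rep β (fun U => F U⁻¹) = wilsonExpectation u1Rep β F := by
  rw [wilsonExpectation_eq_div_integral u1Rep continuous_u1Rep,
    wilsonExpectation_eq_div_integral u1Rep continuous_u1Rep]
  congr 1
  have h := integral_inv_eq_self (fun U : GaugeConfig d L Circle =>
    F U * Real.exp (-β * wilsonAction u1Rep U)) (Measure.pi fun _ : Edge d L => haarProbability Circle)
  simp only [wilsonAction_u1_inv] at h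
  exact h

/-- **Odd observables have zero expectation**: if `F(U⁻¹) = -F(U)` then `⟨F⟩_β = 0`. [folklore] -/
theorem wilsonExpectation_u1_eq_zero_of_odd (β : ℝ) {F : GaugeConfig d L Circle → ℝ}
    (hF : ∀ U, F U⁻¹ = -F U) : wilsonExpectation u1Rep β F = 0 := by
  have h := wilsonExpectation_u1_comp_inv β F
  simp only [hF] at h
  unfold wilsonExpectation at h ⊢
  rw [integral_neg] at h
  linarith

/-- The imaginary part of a plaquette holonomy is odd, hence `⟨Im U_p⟩_β = 0`. [folklore] -/
theorem wilsonExpectation_u1_plaquette_im (β : ℝ) (x : Site d L) (i j : Fin d) :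
    wilsonExpectation u1Rep β
      (fun U => ((plaquetteHolonomy U x i j : Circle) : ℂ).im) = 0 := by
  refine wilsonExpectation_u1_eq_zero_of_odd β fun U => ?_
  simp only [plaquetteHolonomy_inv, Circle.coe_inv_eq_conj, Complex.conj_im]

end Torus


/-! ### Phase flows on `ℤ^d` configurations -/

section Zd

variable {d : ℕ}

/-- The pure-phase configuration `e ↦ e^{i c(e) t}` on `ℤ^d`. [folklore] -/
def zdExpConfig (c : ZdEdge d → ℤ) (t : ℝ) : LGConfig d Circle := fun e => Circle.exp (c e * t)

/-- The phase flow `U ↦ (e ↦ e^{i c(e) t} U_e)` on `U(1)` configurations of `ℤ^d`. [folklore] -/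
def zdPhaseFlow (c : ZdEdge d → ℤ) (t : ℝ) (U : LGConfig d Circle) : LGConfig d Circle :=
  zdExpConfig c t * U

/-- `zdPhaseFlow` edgewise. [folklore] -/
@[simp] theorem zdPhaseFlow_apply (c : ZdEdge d → ℤ) (t : ℝ) (U : LGConfig d Circle) (e : ZdEdge d) :
    zdPhaseFlow c t U e = Circle.exp (c e * t) * U e := rfl

/-- The indicator charge vector of a finite edge set `V` (`1` on `V`, `0` elsewhere): the
vector field `X_V = ∑_{e ∈ V} ∂/∂θ_e`. [folklore] -/
def indicatorCharge (V : Finset (ZdEdge d)) : ZdEdge d → ℤ := fun e => if e ∈ V then 1 else 0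

/-- `indicatorCharge V e ∈ {0, 1}`. [folklore] -/
theorem indicatorCharge_mem (V : Finset (ZdEdge d)) (e : ZdEdge d) :
    indicatorCharge V e = 0 ∨ indicatorCharge V e = 1 := by
  unfold indicatorCharge; split_ifs <;> simp

/-- The charge vector on the torus `(ℤ/Lℤ)^d` induced by a finite edge set `V ⊆ E(ℤ^d)`:
the indicator of the image of `V` under the periodisation of edges. [folklore] -/
def torusCharge (L : ℕ) (V : Finset (ZdEdge d)) : Edge d L → ℤ := fun e =>
  if e ∈ V.image (torusEdge L) then 1 else 0

/-- A torus edge of non-zero induced charge is the image of an edge of `V`. [folklore] -/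
theorem exists_of_torusCharge_ne_zero {L : ℕ} {V : Finset (ZdEdge d)} {e : Edge d L}
    (h : torusCharge L V e ≠ 0) : ∃ v ∈ V, torusEdge L v = e := by
  unfold torusCharge at h
  by_cases he : e ∈ V.image (torusEdge L)
  · simpa [Finset.mem_image] using he
  · rw [if_neg he] at h; exact absurd rfl h

/-- The periodic lift intertwines the torus flow of the induced charge with the `ℤ^d` flow of its
(periodic) pull-back. [folklore] -/
theorem torusLift_phaseFlow (L : ℕ) (c : Edge d L → ℤ) (t : ℝ) (U : GaugeConfig d L Circle) :
    torusLift L (phaseFlow c t U) = zdPhaseFlow (c ∘ torusEdge L) t (torusLift L U) := rfl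

/-- On edges based in the cube `{-n,…,n}^d` (`2n ≤ L`) the pulled-back induced charge of a set
`V` based in the same cube is the indicator of `V` (injectivity of the periodisation). [folklore] -/
theorem torusCharge_torusEdge {n L : ℕ} (hL : 2 * n ≤ L) {V : Finset (ZdEdge d)}
    (hV : ∀ v ∈ V, v.1 ∈ box d n) {e : ZdEdge d} (he : e.1 ∈ box d n) :
    torusCharge (L + 1) V (torusEdge (L + 1) e) = indicatorCharge V e := by
  classical
  unfold torusCharge indicatorCharge
  by_cases heV : e ∈ V
  · rw [if_pos (Finset.mem_image_of_mem _ heV), if_pos heV]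
  · rw [if_neg heV, if_neg]
    intro himg
    obtain ⟨v, hv, hve⟩ := Finset.mem_image.1 himg
    have hinj := torusEdge_injOn (d := d) hL (S := insert e V) (fun x hx => by
      rcases Finset.mem_insert.1 hx with rfl | hx
      · exact he
      · exact hV x hx)
    have := hinj (Finset.mem_coe.2 (Finset.mem_insert_of_mem hv))
      (Finset.mem_coe.2 (Finset.mem_insert_self e V)) hve
    exact heV (this ▸ hv)

/-- **Localisation.** A cylinder observable supported on edges based in `{-n,…,n}^d` sees the
periodised flow of `V` (based in the same cube, `2n ≤ L`) as the plain flow of `V`. [folklore] -/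
theorem dependsOn_zdPhaseFlow_torusCharge {n L : ℕ} (hL : 2 * n ≤ L) {V : Finset (ZdEdge d)}
    (hV : ∀ v ∈ V, v.1 ∈ box d n) {S : Finset (ZdEdge d)} (hS : ∀ e ∈ S, e.1 ∈ box d n)
    {α : Type*} {F : LGConfig d Circle → α} (hF : DependsOn F (S : Set (ZdEdge d))) (t : ℝ)
    (U : LGConfig d Circle) :
    F (zdPhaseFlow (torusCharge (L + 1) V ∘ torusEdge (L + 1)) t U) =
      F (zdPhaseFlow (indicatorCharge V) t U) := by
  refine hF fun e he => ?_
  simp only [zdPhaseFlow_apply, Function.comp_apply,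
    torusCharge_torusEdge hL hV (hS e (Finset.mem_coe.1 he))]

/-- **Localisation through the periodic lift**: for a cylinder observable `F` as above,
`(F ∘ torusLift)(φ^{torus}_t U) = F(φ^{V}_t (torusLift U))`. [folklore] -/
theorem toTorusObservable_phaseFlow {n L : ℕ} (hL : 2 * n ≤ L) {V : Finset (ZdEdge d)}
    (hV : ∀ v ∈ V, v.1 ∈ box d n) {S : Finset (ZdEdge d)} (hS : ∀ e ∈ S, e.1 ∈ box d n)
    {α : Type*} {F : LGConfig d Circle → α} (hF : DependsOn F (S : Set (ZdEdge d))) (t : ℝ)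
    (U : GaugeConfig d (L + 1) Circle) :
    toTorusObservable (L + 1) F (phaseFlow (torusCharge (L + 1) V) t U) =
      F (zdPhaseFlow (indicatorCharge V) t (torusLift (L + 1) U)) := by
  rw [toTorusObservable_apply, torusLift_phaseFlow]
  exact dependsOn_zdPhaseFlow_torusCharge hL hV hS hF t _

/-! ### Holonomies along the `ℤ^d` flow (abelian bookkeeping) -/

/-- Plaquette holonomies are multiplicative in the configuration (`U(1)` is abelian). [folklore] -/
theorem plaquette_mul (U V : LGConfig d Circle) (x : Literature.Probability.LatticeModels.Site d)
    (i j : Fin d) :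
    ZdGaugeConfig.plaquette (U * V) x i j =
      ZdGaugeConfig.plaquette U x i j * ZdGaugeConfig.plaquette V x i j := by
  apply Circle.ext
  simp only [ZdGaugeConfig.plaquette, Pi.mul_apply, Circle.coe_mul, Circle.coe_inv]
  ring

/-- Straight-path holonomies are multiplicative in the configuration. [folklore] -/
theorem line_mul (U V : LGConfig d Circle) (k : Fin d) :
    ∀ (n : ℕ) (y : Literature.Probability.LatticeModels.Site d),
      ZdGaugeConfig.line (U * V) k n y = ZdGaugeConfig.line U k n y * ZdGaugeConfig.line V k n y
  | 0, _ => by simp [ZdGaugeConfig.line]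
  | n + 1, y => by
    rw [ZdGaugeConfig.line, ZdGaugeConfig.line, ZdGaugeConfig.line, line_mul U V k n, Pi.mul_apply]
    exact mul_mul_mul_comm _ _ _ _

/-- Rectangular holonomies are multiplicative in the configuration. [folklore] -/
theorem rectangle_mul (U V : LGConfig d Circle) (x : Literature.Probability.LatticeModels.Site d)
    (i j : Fin d) (R T : ℕ) :
    ZdGaugeConfig.rectangle (U * V) x i j R T =
      ZdGaugeConfig.rectangle U x i j R T * ZdGaugeConfig.rectangle V x i j R T := by
  apply Circle.ext
  simp only [ZdGaugeConfig.rectangle, line_mul, Circle.coe_mul, Circle.coe_inv]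
  ring

/-- The charge of the plaquette `(x; i, j)` of `ℤ^d` under `X_c`:
`c(x,i) + c(x+eᵢ,j) − c(x+eⱼ,i) − c(x,j)`. [folklore] -/
def zdPlaqCharge (c : ZdEdge d → ℤ) (x : Literature.Probability.LatticeModels.Site d) (i j : Fin d) : ℤ :=
  c (x, i) + c (x + Pi.single i 1, j) - c (x + Pi.single j 1, i) - c (x, j)

/-- The charge of an indicator vector field on a plaquette is at most `2` in absolute value.
[folklore] -/
theorem abs_zdPlaqCharge_indicatorCharge_le (V : Finset (ZdEdge d))
    (x : Literature.Probability.LatticeModels.Site d) (i j : Fin d) :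
    |(zdPlaqCharge (indicatorCharge V) x i j : ℝ)| ≤ 2 := by
  unfold zdPlaqCharge
  rcases indicatorCharge_mem V (x, i) with h1 | h1 <;>
  rcases indicatorCharge_mem V (x + Pi.single i 1, j) with h2 | h2 <;>
  rcases indicatorCharge_mem V (x + Pi.single j 1, i) with h3 | h3 <;>
  rcases indicatorCharge_mem V (x, j) with h4 | h4 <;>
  · rw [h1, h2, h3, h4]; norm_num

/-- Plaquette holonomy of the pure-phase configuration on `ℤ^d`. [folklore] -/
theorem plaquette_zdExpConfig (c : ZdEdge d → ℤ) (t : ℝ) (x : Literature.Probability.LatticeModels.Site d)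
    (i j : Fin d) :
    ZdGaugeConfig.plaquette (zdExpConfig c t) x i j = Circle.exp (zdPlaqCharge c x i j * t) := by
  simp only [ZdGaugeConfig.plaquette, zdExpConfig, zdPlaqCharge, ← Circle.exp_neg, ← Circle.exp_add]
  congr 1
  push_cast
  ring

/-- Plaquette holonomies rotate under the `ℤ^d` flow by their charge. [folklore] -/
theorem plaquette_zdPhaseFlow (c : ZdEdge d → ℤ) (t : ℝ) (U : LGConfig d Circle)
    (x : Literature.Probability.LatticeModels.Site d) (i j : Fin d) :
    ZdGaugeConfig.plaquette (zdPhaseFlow c t U) x i j =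
      Circle.exp (zdPlaqCharge c x i j * t) * ZdGaugeConfig.plaquette U x i j := by
  rw [zdPhaseFlow, plaquette_mul, plaquette_zdExpConfig]

/-- The charge of the straight path of `n` steps in direction `k` from `y` under `X_c`
(the sum of `c` over its bonds). [folklore] -/
def lineCharge (c : ZdEdge d → ℤ) (k : Fin d) : ℕ → Literature.Probability.LatticeModels.Site d → ℤ
  | 0, _ => 0
  | n + 1, y => c (y, k) + lineCharge c k n (y + Pi.single k 1)

/-- `lineCharge` as a sum over the bonds `(y + t e_k, k)`, `t < n`. [folklore] -/
theorem lineCharge_eq_sum (c : ZdEdge d → ℤ) (k : Fin d) :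
    ∀ (n : ℕ) (y : Literature.Probability.LatticeModels.Site d),
      lineCharge c k n y = ∑ t ∈ Finset.range n, c (y + Pi.single k (t : ℤ), k)
  | 0, _ => by simp [lineCharge]
  | n + 1, y => by
    rw [lineCharge, lineCharge_eq_sum c k n, Finset.sum_range_succ', add_comm]
    congr 1
    · refine Finset.sum_congr rfl fun t _ => ?_
      rw [add_assoc, ← Pi.single_add, Nat.cast_succ, add_comm (1 : ℤ)]
    · simp

/-- Straight-path holonomy of the pure-phase configuration. [folklore] -/
theorem line_zdExpConfig (c : ZdEdge d → ℤ) (t : ℝ) (k : Fin d) :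
    ∀ (n : ℕ) (y : Literature.Probability.LatticeModels.Site d),
      ZdGaugeConfig.line (zdExpConfig c t) k n y = Circle.exp (lineCharge c k n y * t)
  | 0, _ => by simp [ZdGaugeConfig.line, lineCharge]
  | n + 1, y => by
    rw [ZdGaugeConfig.line, line_zdExpConfig c t k n, lineCharge]
    change Circle.exp (c (y, k) * t) * _ = _
    rw [← Circle.exp_add]
    congr 1
    push_cast
    ring

/-- The charge of the rectangular `R × T` loop at `x` in the `(i, j)` plane under `X_c` — for
`c` the indicator of a set of bonds crossing a dual cell complex, its signed intersection
(linking) number with the loop. [folklore] -/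
def rectCharge (c : ZdEdge d → ℤ) (x : Literature.Probability.LatticeModels.Site d) (i j : Fin d) (R T : ℕ) : ℤ :=
  lineCharge c i R x + lineCharge c j T (x + Pi.single i (R : ℤ)) -
    lineCharge c i R (x + Pi.single j (T : ℤ)) - lineCharge c j T x

/-- Rectangular holonomy of the pure-phase configuration. [folklore] -/
theorem rectangle_zdExpConfig (c : ZdEdge d → ℤ) (t : ℝ) (x : Literature.Probability.LatticeModels.Site d)
    (i j : Fin d) (R T : ℕ) :
    ZdGaugeConfig.rectangle (zdExpConfig c t) x i j R T = Circle.exp (rectCharge c x i j R T * t) := by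
  simp only [ZdGaugeConfig.rectangle, line_zdExpConfig, rectCharge, ← Circle.exp_neg,
    ← Circle.exp_add]
  congr 1
  push_cast
  ring

/-- Rectangular holonomies rotate under the `ℤ^d` flow by the loop charge:
`hol(φ_t U) = e^{i ℓ t} hol(U)`. [folklore] -/
theorem rectangle_zdPhaseFlow (c : ZdEdge d → ℤ) (t : ℝ) (U : LGConfig d Circle)
    (x : Literature.Probability.LatticeModels.Site d) (i j : Fin d) (R T : ℕ) :
    ZdGaugeConfig.rectangle (zdPhaseFlow c t U) x i j R T =
      Circle.exp (rectCharge c x i j R T * t) * ZdGaugeConfig.rectangle U x i j R T := by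
  rw [zdPhaseFlow, rectangle_mul, rectangle_zdExpConfig]

/-- `d/dt Im hol(φ_t U) = ℓ · Re hol(φ_t U)` for the rectangular loop. [folklore] -/
theorem hasDerivAt_rectangle_im_zdPhaseFlow (c : ZdEdge d → ℤ) (U : LGConfig d Circle)
    (x : Literature.Probability.LatticeModels.Site d) (i j : Fin d) (R T : ℕ) (t : ℝ) :
    HasDerivAt
      (fun s => ((ZdGaugeConfig.rectangle (zdPhaseFlow c s U) x i j R T : Circle) : ℂ).im)
      ((rectCharge c x i j R T : ℝ) *
        ((ZdGaugeConfig.rectangle (zdPhaseFlow c t U) x i j R T : Circle) : ℂ).re) t := by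
  simp only [rectangle_zdPhaseFlow]
  exact hasDerivAt_coe_exp_mul_im _ _ _

/-! ### Transfer of the action derivative: torus plaquette sums as `ℤ^d` sums -/

/-- The torus plaquette below a plaquette of `ℤ^d`. [folklore] -/
def plaqProj (L : ℕ) (p : ZdPlaquette d) : Plaquette d L := (Torus.proj L p.1, p.2)

/-- Shifting a point of the cube `{-n,…,n}^d` by `± e_i` lands in `{-(n+1),…,n+1}^d`. [folklore] -/
theorem add_single_mem_box_succ {n : ℕ} {x : Literature.Probability.LatticeModels.Site d}
    (hx : x ∈ box d n) (i : Fin d) {s : ℤ} (hs : s = 1 ∨ s = -1) :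
    x + Pi.single i s ∈ box d (n + 1) := by
  rw [mem_box] at hx ⊢
  intro k
  have hk := hx k
  simp only [Pi.add_apply, Pi.single_apply, Nat.cast_succ]
  split_ifs
  · rcases hs with rfl | rfl <;> constructor <;> linarith
  · constructor <;> linarith

/-- The cube `{-n,…,n}^d` lies in `{-(n+1),…,n+1}^d`. [folklore] -/
theorem mem_box_succ {n : ℕ} {x : Literature.Probability.LatticeModels.Site d} (hx : x ∈ box d n) :
    x ∈ box d (n + 1) :=
  box_mono d (Nat.le_succ n) hx

/-- `Torus.proj` commutes with unit shifts: `(proj x).shift i = proj (x + e_i)`. [folklore] -/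
theorem torusProj_shift (L : ℕ) (x : Literature.Probability.LatticeModels.Site d) (i : Fin d) :
    QuantumFieldTheory.Site.shift (Torus.proj L x) i = Torus.proj L (x + Pi.single i 1) := by
  rw [QuantumFieldTheory.Site.shift, torusProj_add_single, Int.cast_one]

/-- **The induced charge of a projected plaquette is the `ℤ^d` charge** (`p` based in
`{-n,…,n}^d`, `V` based there, `2(n+1) ≤ L`). [folklore] -/
theorem plaqCharge_torusCharge_plaqProj {n L : ℕ} (hL : 2 * (n + 1) ≤ L) {V : Finset (ZdEdge d)}
    (hV : ∀ v ∈ V, v.1 ∈ box d n) {x : Literature.Probability.LatticeModels.Site d}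
    (hx : x ∈ box d n) (i j : Fin d) :
    plaqCharge (torusCharge (L + 1) V) (Torus.proj (L + 1) x) i j =
      zdPlaqCharge (indicatorCharge V) x i j := by
  have hV' : ∀ v ∈ V, v.1 ∈ box d (n + 1) := fun v hv => mem_box_succ (hV v hv)
  have key : ∀ e : ZdEdge d, e.1 ∈ box d (n + 1) →
      torusCharge (L + 1) V (Torus.proj (L + 1) e.1, e.2) = indicatorCharge V e :=
    fun e he => torusCharge_torusEdge hL hV' he
  unfold plaqCharge zdPlaqCharge
  rw [torusProj_shift, torusProj_shift, key (x, i) (mem_box_succ hx),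
    key (x + Pi.single i 1, j) (add_single_mem_box_succ hx i (Or.inl rfl)),
    key (x + Pi.single j 1, i) (add_single_mem_box_succ hx j (Or.inl rfl)),
    key (x, j) (mem_box_succ hx)]

/-- **Torus plaquettes away from `V` carry no induced charge**: a torus plaquette with non-zero
induced charge is the projection of a plaquette of `ℤ^d` based in `{-(n+1),…,n+1}^d`
(`V` based in `{-n,…,n}^d`). [folklore] -/
theorem exists_plaqProj_of_plaqCharge_ne_zero {n L : ℕ} {V : Finset (ZdEdge d)}
    (hV : ∀ v ∈ V, v.1 ∈ box d n) {q : Plaquette d (L + 1)}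
    (hq : plaqCharge (torusCharge (L + 1) V) q.1 q.2.1.1 q.2.1.2 ≠ 0) :
    ∃ p ∈ (box d (n + 1) ×ˢ Finset.univ : Finset (ZdPlaquette d)), plaqProj (L + 1) p = q := by
  -- one of the four bonds carries charge
  have h4 : torusCharge (L + 1) V (q.1, q.2.1.1) ≠ 0 ∨
      torusCharge (L + 1) V (q.1.shift q.2.1.1, q.2.1.2) ≠ 0 ∨
      torusCharge (L + 1) V (q.1.shift q.2.1.2, q.2.1.1) ≠ 0 ∨
      torusCharge (L + 1) V (q.1, q.2.1.2) ≠ 0 := by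
    by_contra h
    push Not at h
    obtain ⟨h1, h2, h3, h4⟩ := h
    exact hq (by unfold plaqCharge; rw [h1, h2, h3, h4]; simp)
  have mk : ∀ (y : Literature.Probability.LatticeModels.Site d), y ∈ box d (n + 1) →
      Torus.proj (L + 1) y = q.1 →
      ∃ p ∈ (box d (n + 1) ×ˢ Finset.univ : Finset (ZdPlaquette d)), plaqProj (L + 1) p = q :=
    fun y hy hpy => ⟨(y, q.2), Finset.mem_product.2 ⟨hy, Finset.mem_univ _⟩,
      Prod.ext hpy rfl⟩
  rcases h4 with h | h | h | h
  · obtain ⟨v, hv, hve⟩ := exists_of_torusCharge_ne_zero h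
    exact mk v.1 (mem_box_succ (hV v hv)) (congrArg Prod.fst hve)
  · obtain ⟨v, hv, hve⟩ := exists_of_torusCharge_ne_zero h
    refine mk (v.1 + Pi.single q.2.1.1 (-1)) (add_single_mem_box_succ (hV v hv) _ (Or.inr rfl)) ?_
    have h1 : Torus.proj (L + 1) v.1 = q.1.shift q.2.1.1 := congrArg Prod.fst hve
    rw [torusProj_add_single, h1, QuantumFieldTheory.Site.shift, add_assoc, ← Pi.single_add]
    simp
  · obtain ⟨v, hv, hve⟩ := exists_of_torusCharge_ne_zero h
    refine mk (v.1 + Pi.single q.2.1.2 (-1)) (add_single_mem_box_succ (hV v hv) _ (Or.inr rfl)) ?_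
    have h1 : Torus.proj (L + 1) v.1 = q.1.shift q.2.1.2 := congrArg Prod.fst hve
    rw [torusProj_add_single, h1, QuantumFieldTheory.Site.shift, add_assoc, ← Pi.single_add]
    simp
  · obtain ⟨v, hv, hve⟩ := exists_of_torusCharge_ne_zero h
    exact mk v.1 (mem_box_succ (hV v hv)) (congrArg Prod.fst hve)

/-- `plaqProj (L+1)` is injective on plaquettes based in `{-m,…,m}^d`, `2m ≤ L`. [folklore] -/
theorem plaqProj_injOn {m L : ℕ} (hL : 2 * m ≤ L) :
    Set.InjOn (plaqProj (d := d) (L + 1)) (box d m ×ˢ Finset.univ : Finset (ZdPlaquette d)) := by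
  intro p hp p' hp' h
  simp only [plaqProj, Prod.mk.injEq] at h
  exact Prod.ext (torusProj_succ_injOn_box hL (Finset.mem_product.1 (Finset.mem_coe.1 hp)).1
    (Finset.mem_product.1 (Finset.mem_coe.1 hp')).1 h.1) h.2

/-- **Sum transfer.** For `V` based in `{-n,…,n}^d` and `2(n+2) ≤ L`, a torus plaquette sum
weighted by the induced charges is the corresponding sum over the plaquettes of `ℤ^d` based in
`{-(n+1),…,n+1}^d`, weighted by the `ℤ^d` charges of `V`. [folklore] -/
theorem sum_plaqCharge_torusCharge {n L : ℕ} (hL : 2 * (n + 2) ≤ L) {V : Finset (ZdEdge d)}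
    (hV : ∀ v ∈ V, v.1 ∈ box d n) (g : Plaquette d (L + 1) → ℝ) :
    ∑ q : Plaquette d (L + 1), (plaqCharge (torusCharge (L + 1) V) q.1 q.2.1.1 q.2.1.2 : ℝ) * g q =
      ∑ p ∈ (box d (n + 1) ×ˢ Finset.univ : Finset (ZdPlaquette d)),
        (zdPlaqCharge (indicatorCharge V) p.1 p.2.1.1 p.2.1.2 : ℝ) * g (plaqProj (L + 1) p) := by
  classical
  have hV' : ∀ v ∈ V, v.1 ∈ box d (n + 1) := fun v hv => mem_box_succ (hV v hv)
  have hinj := plaqProj_injOn (d := d) (m := n + 1) (L := L) (by omega)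
  rw [← Finset.sum_subset (Finset.subset_univ
      ((box d (n + 1) ×ˢ Finset.univ : Finset (ZdPlaquette d)).image (plaqProj (L + 1))))
      (fun q _ hq => ?_)]
  · rw [Finset.sum_image hinj]
    refine Finset.sum_congr rfl fun p hp => ?_
    rw [plaqProj, plaqCharge_torusCharge_plaqProj (n := n + 1) (by omega) hV'
      (Finset.mem_product.1 hp).1]
  · have h0 : plaqCharge (torusCharge (L + 1) V) q.1 q.2.1.1 q.2.1.2 = 0 := by
      by_contra h
      obtain ⟨p, hp, hpq⟩ := exists_plaqProj_of_plaqCharge_ne_zero hV h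
      exact hq (Finset.mem_image.2 ⟨p, hp, hpq⟩)
    rw [h0, Int.cast_zero, zero_mul]

/-- **The action derivative of the induced charge, read on `ℤ^d`**: for `V` based in
`{-n,…,n}^d` and `2(n+2) ≤ L`,
`X S_{torus}(U) = ∑_{p based in {-(n+1),…,n+1}^d} n_p(V) · Im (torusLift U)_p`. [folklore] -/
theorem actionFlowDeriv_torusCharge {n L : ℕ} (hL : 2 * (n + 2) ≤ L) {V : Finset (ZdEdge d)}
    (hV : ∀ v ∈ V, v.1 ∈ box d n) (U : GaugeConfig d (L + 1) Circle) :
    actionFlowDeriv (torusCharge (L + 1) V) U =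
      ∑ p ∈ (box d (n + 1) ×ˢ Finset.univ : Finset (ZdPlaquette d)),
        (zdPlaqCharge (indicatorCharge V) p.1 p.2.1.1 p.2.1.2 : ℝ) *
          ((ZdGaugeConfig.plaquette (torusLift (L + 1) U) p.1 p.2.1.1 p.2.1.2 : Circle) : ℂ).im := by
  unfold actionFlowDeriv
  rw [sum_plaqCharge_torusCharge hL hV]
  simp only [plaqProj, plaquette_torusLift]

end Zd


/-! ### `U(1)` loop and plaquette observables on `ℤ^d` -/

section Observables

variable {d : ℕ}

/-- `cos θ(C)`: the real part of the holonomy of the rectangular `R × T` loop at `x` in the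
`(i, j)` plane — the `U(1)` Wilson loop observable `Re χ(hol)` (`χ = id` on `U(1) ⊆ ℂ`).
[folklore] -/
def u1LoopRe (x : Literature.Probability.LatticeModels.Site d) (i j : Fin d) (R T : ℕ)
    (U : LGConfig d Circle) : ℝ :=
  ((ZdGaugeConfig.rectangle U x i j R T : Circle) : ℂ).re

/-- `sin θ(C)`: the imaginary part of the holonomy of the rectangular loop. [folklore] -/
def u1LoopIm (x : Literature.Probability.LatticeModels.Site d) (i j : Fin d) (R T : ℕ)
    (U : LGConfig d Circle) : ℝ :=
  ((ZdGaugeConfig.rectangle U x i j R T : Circle) : ℂ).im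

/-- `sin θ_p`: the imaginary part of the plaquette holonomy at `x` in the `(i, j)` plane (the
lattice `U(1)` field strength / electric flux observable). [folklore] -/
def u1PlaqIm (x : Literature.Probability.LatticeModels.Site d) (i j : Fin d) (U : LGConfig d Circle) : ℝ :=
  ((ZdGaugeConfig.plaquette U x i j : Circle) : ℂ).im

/-- `|Re z| ≤ 1` on the unit circle. [folklore] -/
theorem abs_re_le_one (z : Circle) : |(z : ℂ).re| ≤ 1 :=
  (Complex.abs_re_le_norm _).trans_eq (Circle.norm_coe z)

/-- `|Im z| ≤ 1` on the unit circle. [folklore] -/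
theorem abs_im_le_one (z : Circle) : |(z : ℂ).im| ≤ 1 :=
  (Complex.abs_im_le_norm _).trans_eq (Circle.norm_coe z)

/-- `|u1LoopRe| ≤ 1`. [folklore] -/
theorem abs_u1LoopRe_le (x : Literature.Probability.LatticeModels.Site d) (i j : Fin d) (R T : ℕ)
    (U : LGConfig d Circle) : |u1LoopRe x i j R T U| ≤ 1 :=
  abs_re_le_one _

/-- `|u1LoopIm| ≤ 1`. [folklore] -/
theorem abs_u1LoopIm_le (x : Literature.Probability.LatticeModels.Site d) (i j : Fin d) (R T : ℕ)
    (U : LGConfig d Circle) : |u1LoopIm x i j R T U| ≤ 1 :=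
  abs_im_le_one _

/-- `|u1PlaqIm| ≤ 1`. [folklore] -/
theorem abs_u1PlaqIm_le (x : Literature.Probability.LatticeModels.Site d) (i j : Fin d)
    (U : LGConfig d Circle) : |u1PlaqIm x i j U| ≤ 1 :=
  abs_im_le_one _

/-- `u1LoopRe` is continuous (product topology). [folklore] -/
theorem continuous_u1LoopRe (x : Literature.Probability.LatticeModels.Site d) (i j : Fin d) (R T : ℕ) :
    Continuous (u1LoopRe x i j R T) :=
  Complex.continuous_re.comp (continuous_subtype_val.comp (AreaLaw.continuous_rectangle (G := Circle) x i j R T))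

/-- `u1LoopIm` is continuous. [folklore] -/
theorem continuous_u1LoopIm (x : Literature.Probability.LatticeModels.Site d) (i j : Fin d) (R T : ℕ) :
    Continuous (u1LoopIm x i j R T) :=
  Complex.continuous_im.comp (continuous_subtype_val.comp (AreaLaw.continuous_rectangle (G := Circle) x i j R T))

/-- `u1PlaqIm` is continuous. [folklore] -/
theorem continuous_u1PlaqIm (x : Literature.Probability.LatticeModels.Site d) (i j : Fin d) :
    Continuous (u1PlaqIm x i j) :=
  Complex.continuous_im.comp (continuous_subtype_val.comp (AreaLaw.continuous_plaquette (G := Circle) x i j))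

/-- `u1LoopRe` is a cylinder observable on the bonds of the loop. [folklore] -/
theorem dependsOn_u1LoopRe (x : Literature.Probability.LatticeModels.Site d) (i j : Fin d) (R T : ℕ) :
    DependsOn (u1LoopRe x i j R T) (loopEdges x i j R T : Set (ZdEdge d)) := fun U V h => by
  simp only [u1LoopRe, AreaLaw.dependsOn_rectangle x i j R T h]

/-- `u1LoopIm` is a cylinder observable on the bonds of the loop. [folklore] -/
theorem dependsOn_u1LoopIm (x : Literature.Probability.LatticeModels.Site d) (i j : Fin d) (R T : ℕ) :
    DependsOn (u1LoopIm x i j R T) (loopEdges x i j R T : Set (ZdEdge d)) := fun U V h => by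
  simp only [u1LoopIm, AreaLaw.dependsOn_rectangle x i j R T h]

/-- `u1PlaqIm` is a cylinder observable on the four bonds of the plaquette. [folklore] -/
theorem dependsOn_u1PlaqIm (x : Literature.Probability.LatticeModels.Site d) (i j : Fin d) :
    DependsOn (u1PlaqIm x i j) (Plaq.bonds (x, i, j) : Set (ZdEdge d)) := fun U V h => by
  simp only [u1PlaqIm, AreaLaw.dependsOn_plaquette_bonds (x, i, j) h]

/-- The periodic lift `torusLift L` is continuous (twin of
`Literature.MathematicalPhysics.QuantumLattice.continuous_torusLift` of
`LatticeGaugeDLRGibbsProofs.lean`, which is not in this file's import closure). [folklore] -/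
theorem continuous_torusLift' {G : Type*} [TopologicalSpace G] (L : ℕ) :
    Continuous (torusLift (d := d) (G := G) L) :=
  continuous_pi fun _ => continuous_apply _

/-- The torus restriction of a continuous observable is continuous. [folklore] -/
theorem continuous_toTorusObservable {G : Type*} [TopologicalSpace G] (L : ℕ)
    {F : LGConfig d G → ℝ} (hF : Continuous F) : Continuous (toTorusObservable L F) :=
  hF.comp (continuous_torusLift' L)

end Observables

/-! ### The linking Ward identity: finite torus, then infinite-volume limit states -/

section Linking

variable {d : ℕ}

/-- Linearity of the torus expectation over finite linear combinations of continuous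
observables (both sides as ratios of Haar integrals). [folklore] -/
theorem wilsonExpectation_u1_finset_sum {L : ℕ} [NeZero L] (β : ℝ) {ι : Type*} (s : Finset ι)
    (a : ι → ℝ) {G : ι → GaugeConfig d L Circle → ℝ} (hG : ∀ k ∈ s, Continuous (G k)) :
    wilsonExpectation u1Rep β (fun U => ∑ k ∈ s, a k * G k U) =
      ∑ k ∈ s, a k * wilsonExpectation u1Rep β (G k) := by
  have hwc : Continuous fun U : GaugeConfig d L Circle => Real.exp (-β * wilsonAction u1Rep U) :=
    Real.continuous_exp.comp (continuous_const.mul (continuous_wilsonAction u1Rep continuous_u1Rep))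
  simp only [wilsonExpectation_eq_div_integral u1Rep continuous_u1Rep]
  simp_rw [← mul_div_assoc, ← Finset.sum_div]
  congr 1
  simp_rw [Finset.sum_mul, mul_assoc]
  rw [integral_finsetSum _ fun k hk =>
    (integrable_u1TorusHaar_of_continuous
      (H := fun U => G k U * Real.exp (-β * wilsonAction u1Rep U)) ((hG k hk).mul hwc)).const_mul
      (a k)]
  simp_rw [integral_const_mul]

/-- **The `U(1)` linking Ward identity on a finite torus, read on `ℤ^d`.** For a finite set `V`
of bonds of `ℤ^d` based in `{-n,…,n}^d`, a rectangular loop `C` with bonds based there, and the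
torus `(ℤ/(L+1)ℤ)^d` with `2(n+2) ≤ L`:
`ℓ · ⟨cos θ(C)⟩_{L+1,β} = β ∑_p n_p(V) ⟨sin θ(C) sin θ_p⟩_{L+1,β}`, where `ℓ = rectCharge 1_V C`
is the linking (signed intersection) number of `C` with the dual cells of `V`, `n_p(V)` the
plaquette charges (non-zero only on the dual boundary of `V`), the sum over the plaquettes of
`ℤ^d` based in `{-(n+1),…,n+1}^d`, and observables are read on the torus through the periodic
lift. Proof: the torus Ward identity for the induced charge `torusCharge (L+1) V` and the flow
derivative `X sin θ(C) = ℓ cos θ(C)`, localised to `ℤ^d`. [folklore] -/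
theorem u1_torus_linking_ward_identity (β : ℝ) {n L : ℕ} (hL : 2 * (n + 2) ≤ L)
    {V : Finset (ZdEdge d)} (hV : ∀ v ∈ V, v.1 ∈ box d n)
    {x : Literature.Probability.LatticeModels.Site d} {i j : Fin d} {R T : ℕ}
    (hC : ∀ e ∈ loopEdges x i j R T, e.1 ∈ box d n) :
    wilsonExpectation (L := L + 1) u1Rep β (toTorusObservable (L + 1)
        (fun U => (rectCharge (indicatorCharge V) x i j R T : ℝ) * u1LoopRe x i j R T U)) =
      β * ∑ p ∈ (box d (n + 1) ×ˢ Finset.univ : Finset (ZdPlaquette d)),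
        (zdPlaqCharge (indicatorCharge V) p.1 p.2.1.1 p.2.1.2 : ℝ) *
          wilsonExpectation (L := L + 1) u1Rep β (toTorusObservable (L + 1)
            (fun U => u1LoopIm x i j R T U * u1PlaqIm p.1 p.2.1.1 p.2.1.2 U)) := by
  have hn : 2 * n ≤ L := by omega
  -- the torus Ward identity for `F = sin θ(C) ∘ torusLift`
  have hF : Continuous (toTorusObservable (L + 1) (u1LoopIm x i j R T)) :=
    continuous_toTorusObservable _ (continuous_u1LoopIm x i j R T)
  have hXF : Continuous (toTorusObservable (L + 1)
      (fun U => (rectCharge (indicatorCharge V) x i j R T : ℝ) * u1LoopRe x i j R T U)) :=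
    continuous_toTorusObservable _ (continuous_const.mul (continuous_u1LoopRe x i j R T))
  have hderiv : ∀ (U : GaugeConfig d (L + 1) Circle) (t : ℝ),
      HasDerivAt (fun s => toTorusObservable (L + 1) (u1LoopIm x i j R T)
          (phaseFlow (torusCharge (L + 1) V) s U))
        (toTorusObservable (L + 1)
          (fun U => (rectCharge (indicatorCharge V) x i j R T : ℝ) * u1LoopRe x i j R T U)
          (phaseFlow (torusCharge (L + 1) V) t U)) t := by
    intro U t
    have e1 : (fun s => toTorusObservable (L + 1) (u1LoopIm x i j R T)
        (phaseFlow (torusCharge (L + 1) V) s U)) = fun s =>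
        ((ZdGaugeConfig.rectangle (zdPhaseFlow (indicatorCharge V) s (torusLift (L + 1) U))
          x i j R T : Circle) : ℂ).im :=
      funext fun s => toTorusObservable_phaseFlow hn hV hC (dependsOn_u1LoopIm x i j R T) s U
    have hdep : DependsOn
        (fun U => (rectCharge (indicatorCharge V) x i j R T : ℝ) * u1LoopRe x i j R T U)
        (loopEdges x i j R T : Set (ZdEdge d)) := fun U U' h => by
      simp only [dependsOn_u1LoopRe x i j R T h]
    have e2 : toTorusObservable (L + 1)
        (fun U => (rectCharge (indicatorCharge V) x i j R T : ℝ) * u1LoopRe x i j R T U)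
        (phaseFlow (torusCharge (L + 1) V) t U) =
        (rectCharge (indicatorCharge V) x i j R T : ℝ) *
          ((ZdGaugeConfig.rectangle (zdPhaseFlow (indicatorCharge V) t (torusLift (L + 1) U))
            x i j R T : Circle) : ℂ).re :=
      toTorusObservable_phaseFlow hn hV hC hdep t U
    rw [e1, e2]
    exact hasDerivAt_rectangle_im_zdPhaseFlow _ _ x i j R T t
  rw [u1_torus_ward_identity (torusCharge (L + 1) V) β hF hXF hderiv]
  congr 1
  -- read the action derivative on `ℤ^d` and use linearity
  have hfun : (fun U : GaugeConfig d (L + 1) Circle =>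
      toTorusObservable (L + 1) (u1LoopIm x i j R T) U *
        actionFlowDeriv (torusCharge (L + 1) V) U) =
      fun U => ∑ p ∈ (box d (n + 1) ×ˢ Finset.univ : Finset (ZdPlaquette d)),
        (zdPlaqCharge (indicatorCharge V) p.1 p.2.1.1 p.2.1.2 : ℝ) *
          toTorusObservable (L + 1)
            (fun U => u1LoopIm x i j R T U * u1PlaqIm p.1 p.2.1.1 p.2.1.2 U) U := by
    funext U
    rw [actionFlowDeriv_torusCharge hL hV, Finset.mul_sum]
    refine Finset.sum_congr rfl fun p _ => ?_
    simp only [toTorusObservable_apply, u1PlaqIm]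
    ring
  rw [hfun, wilsonExpectation_u1_finset_sum β _
    (fun p : ZdPlaquette d => (zdPlaqCharge (indicatorCharge V) p.1 p.2.1.1 p.2.1.2 : ℝ))
    (G := fun p : ZdPlaquette d => toTorusObservable (L + 1)
      (fun U => u1LoopIm x i j R T U * u1PlaqIm p.1 p.2.1.1 p.2.1.2 U))
    fun p _ => continuous_toTorusObservable _
      ((continuous_u1LoopIm x i j R T).mul (continuous_u1PlaqIm _ _ _))]

/-- **`⟨sin θ_p⟩ = 0` on the torus, read on `ℤ^d`** (inversion symmetry). [folklore] -/
theorem wilsonExpectation_toTorusObservable_u1PlaqIm {L : ℕ} [NeZero L] (β : ℝ)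
    (x : Literature.Probability.LatticeModels.Site d) (i j : Fin d) :
    wilsonExpectation (L := L) u1Rep β (toTorusObservable L (u1PlaqIm x i j)) = 0 := by
  have h : toTorusObservable L (u1PlaqIm x i j) =
      fun U => ((plaquetteHolonomy U (Torus.proj L x) i j : Circle) : ℂ).im := by
    funext U
    simp only [toTorusObservable_apply, u1PlaqIm, plaquette_torusLift]
  rw [h]
  exact wilsonExpectation_u1_plaquette_im β _ i j

/-- **`⟨sin θ_p⟩_μ = 0` for every infinite-volume limit state `μ` of Wilson-action `U(1)`**
(limit of the torus identities). [folklore] -/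
theorem integral_u1PlaqIm_eq_zero {β : ℝ} {μ : Measure (LGConfig d Circle)}
    (hμ : μ ∈ infiniteVolumeLimitPoints (d := d) u1Rep β)
    (x : Literature.Probability.LatticeModels.Site d) (i j : Fin d) :
    ∫ U, u1PlaqIm x i j U ∂μ = 0 := by
  obtain ⟨Ls, -, -, hconv⟩ := hμ
  have h := hconv (u1PlaqIm x i j) _ (dependsOn_u1PlaqIm x i j) (continuous_u1PlaqIm x i j)
    ⟨1, abs_u1PlaqIm_le x i j⟩
  simp only [wilsonExpectation_toTorusObservable_u1PlaqIm] at h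
  exact (tendsto_nhds_unique h tendsto_const_nhds).symm ▸ rfl

/-- **The `U(1)` linking (Gauss-law) Ward identity for infinite-volume limit states.** For
Wilson-action `U(1)` lattice gauge theory on `ℤ^d` at any `β`, every infinite-volume limit point
`μ` of the torus states, every finite set `V` of bonds and every rectangular loop `C`:
`ℓ(C,V) · E_μ[cos θ(C)] = β ∑_p n_p(V) · E_μ[sin θ(C) sin θ_p]`, with `ℓ(C,V) = rectCharge 1_V C`
the signed intersection number of `C` with `V`, `n_p(V) = zdPlaqCharge 1_V p ∈ {0, ±1, ±2}` the
plaquette charges (supported on the plaquettes dual to the boundary of the dual chain of `V`),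
and the (finite) sum over the plaquettes based in a cube containing `V` and its neighbours. It
is the `L → ∞` limit of `u1_torus_linking_ward_identity` along the tori defining `μ` (both sides
are expectations of bounded continuous cylinder observables). [folklore] -/
theorem u1_linking_ward_identity {β : ℝ} {μ : Measure (LGConfig d Circle)}
    (hμ : μ ∈ infiniteVolumeLimitPoints (d := d) u1Rep β) {n : ℕ} {V : Finset (ZdEdge d)}
    (hV : ∀ v ∈ V, v.1 ∈ box d n) {x : Literature.Probability.LatticeModels.Site d} {i j : Fin d}
    {R T : ℕ} (hC : ∀ e ∈ loopEdges x i j R T, e.1 ∈ box d n) :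
    (rectCharge (indicatorCharge V) x i j R T : ℝ) * ∫ U, u1LoopRe x i j R T U ∂μ =
      β * ∑ p ∈ (box d (n + 1) ×ˢ Finset.univ : Finset (ZdPlaquette d)),
        (zdPlaqCharge (indicatorCharge V) p.1 p.2.1.1 p.2.1.2 : ℝ) *
          ∫ U, u1LoopIm x i j R T U * u1PlaqIm p.1 p.2.1.1 p.2.1.2 U ∂μ := by
  classical
  obtain ⟨Ls, hLs, -, hconv⟩ := hμ
  -- the left observable
  have hdepXF : DependsOn
      (fun U => (rectCharge (indicatorCharge V) x i j R T : ℝ) * u1LoopRe x i j R T U)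
      (loopEdges x i j R T : Set (ZdEdge d)) := fun U U' h => by
    simp only [dependsOn_u1LoopRe x i j R T h]
  have hlimXF := hconv
    (fun U => (rectCharge (indicatorCharge V) x i j R T : ℝ) * u1LoopRe x i j R T U) _ hdepXF
    (continuous_const.mul (continuous_u1LoopRe x i j R T))
    ⟨|(rectCharge (indicatorCharge V) x i j R T : ℝ)|, fun U => by
      rw [abs_mul]; exact mul_le_of_le_one_right (abs_nonneg _) (abs_u1LoopRe_le x i j R T U)⟩
  -- the right observables
  have hlimG : ∀ p : ZdPlaquette d, Tendsto (fun k : ℕ =>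
      wilsonExpectation (L := Ls k + 1) u1Rep β (toTorusObservable (Ls k + 1)
        (fun U => u1LoopIm x i j R T U * u1PlaqIm p.1 p.2.1.1 p.2.1.2 U))) atTop
      (𝓝 (∫ U, u1LoopIm x i j R T U * u1PlaqIm p.1 p.2.1.1 p.2.1.2 U ∂μ)) := fun p =>
    hconv (fun U => u1LoopIm x i j R T U * u1PlaqIm p.1 p.2.1.1 p.2.1.2 U)
      (loopEdges x i j R T ∪ Plaq.bonds (p.1, p.2.1.1, p.2.1.2))
      (by
        rw [IsCylinder, Finset.coe_union]
        exact AreaLaw.dependsOn_mul (dependsOn_u1LoopIm x i j R T) (dependsOn_u1PlaqIm _ _ _))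
      ((continuous_u1LoopIm x i j R T).mul (continuous_u1PlaqIm _ _ _))
      ⟨1, fun U => by
        rw [abs_mul]
        exact mul_le_one₀ (abs_u1LoopIm_le x i j R T U) (abs_nonneg _) (abs_u1PlaqIm_le _ _ _ U)⟩
  have hlimRHS := (tendsto_finsetSum (box d (n + 1) ×ˢ Finset.univ : Finset (ZdPlaquette d))
    fun p _ => (hlimG p).const_mul
      (zdPlaqCharge (indicatorCharge V) p.1 p.2.1.1 p.2.1.2 : ℝ)).const_mul β
  -- eventual equality along the tori
  have hev : ∀ᶠ k : ℕ in atTop,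
      β * ∑ p ∈ (box d (n + 1) ×ˢ Finset.univ : Finset (ZdPlaquette d)),
        (zdPlaqCharge (indicatorCharge V) p.1 p.2.1.1 p.2.1.2 : ℝ) *
          wilsonExpectation (L := Ls k + 1) u1Rep β (toTorusObservable (Ls k + 1)
            (fun U => u1LoopIm x i j R T U * u1PlaqIm p.1 p.2.1.1 p.2.1.2 U)) =
      wilsonExpectation (L := Ls k + 1) u1Rep β (toTorusObservable (Ls k + 1)
        (fun U => (rectCharge (indicatorCharge V) x i j R T : ℝ) * u1LoopRe x i j R T U)) := by
    filter_upwards [hLs.tendsto_atTop.eventually (eventually_ge_atTop (2 * (n + 2)))] with k hk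
    exact (u1_torus_linking_ward_identity β hk hV hC).symm
  have h := tendsto_nhds_unique hlimXF (hlimRHS.congr' hev)
  rw [integral_const_mul] at h
  exact h

end Linking


/-! ### Gauge invariance of the observables; bridge to the tree's walk holonomies -/

section Gauge

variable {d : ℕ}

/-- Gauge covariance of straight-path holonomies:
`line(U^g) = g(y) · line(U) · g(y + n e_k)⁻¹`. [folklore] -/
theorem line_gaugeTransformZd {G : Type*} [Group G] (g : Literature.Probability.LatticeModels.Site d → G)
    (U : LGConfig d G) (k : Fin d) :
    ∀ (n : ℕ) (y : Literature.Probability.LatticeModels.Site d),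
      ZdGaugeConfig.line (gaugeTransformZd g U) k n y =
        g y * ZdGaugeConfig.line U k n y * (g (y + Pi.single k (n : ℤ)))⁻¹
  | 0, y => by simp [ZdGaugeConfig.line]
  | n + 1, y => by
    rw [ZdGaugeConfig.line, ZdGaugeConfig.line, line_gaugeTransformZd g U k n]
    have h : y + Pi.single k (1 : ℤ) + Pi.single k (n : ℤ) = y + Pi.single k ((n + 1 : ℕ) : ℤ) := by
      rw [add_assoc, ← Pi.single_add, Nat.cast_succ, add_comm (1 : ℤ)]
    rw [h]
    simp only [gaugeTransformZd]
    group

/-- Gauge covariance of rectangular holonomies: `hol(U^g) = g(x) · hol(U) · g(x)⁻¹`. [folklore] -/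
theorem rectangle_gaugeTransformZd {G : Type*} [Group G] (g : Literature.Probability.LatticeModels.Site d → G)
    (U : LGConfig d G) (x : Literature.Probability.LatticeModels.Site d) (i j : Fin d) (R T : ℕ) :
    ZdGaugeConfig.rectangle (gaugeTransformZd g U) x i j R T =
      g x * ZdGaugeConfig.rectangle U x i j R T * (g x)⁻¹ := by
  simp only [ZdGaugeConfig.rectangle, line_gaugeTransformZd,
    add_right_comm x (Pi.single j (T : ℤ)) (Pi.single i (R : ℤ))]
  group

/-- The `U(1)` loop observable `cos θ(C)` is gauge invariant. [folklore] -/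
theorem isZdGaugeInvariant_u1LoopRe (x : Literature.Probability.LatticeModels.Site d) (i j : Fin d) (R T : ℕ) :
    IsZdGaugeInvariant (u1LoopRe x i j R T) := fun g U => by
  simp only [u1LoopRe, rectangle_gaugeTransformZd, mul_inv_cancel_comm]

/-- The `U(1)` loop observable `sin θ(C)` is gauge invariant. [folklore] -/
theorem isZdGaugeInvariant_u1LoopIm (x : Literature.Probability.LatticeModels.Site d) (i j : Fin d) (R T : ℕ) :
    IsZdGaugeInvariant (u1LoopIm x i j R T) := fun g U => by
  simp only [u1LoopIm, rectangle_gaugeTransformZd, mul_inv_cancel_comm]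

/-- The `U(1)` plaquette observable `sin θ_p` is gauge invariant. [folklore] -/
theorem isZdGaugeInvariant_u1PlaqIm (x : Literature.Probability.LatticeModels.Site d) (i j : Fin d) :
    IsZdGaugeInvariant (u1PlaqIm x i j) := fun g U => by
  have h := plaquetteHolonomyZd_gaugeTransformZd g U x i j
  rw [mul_inv_cancel_comm] at h
  exact congrArg (fun z : Circle => (z : ℂ).im) h

/-- Straight walks have the straight-path holonomy `ZdGaugeConfig.line`. [folklore] -/
theorem walkHolonomy_lineWalk_eq_line {G : Type*} [Group G] (U : LGConfig d G) (k : Fin d) :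
    ∀ (n : ℕ) (y : Literature.Probability.LatticeModels.Site d),
      walkHolonomy U (lineWalk k n y) = ZdGaugeConfig.line U k n y
  | 0, y => by simp [lineWalk, ZdGaugeConfig.line]
  | n + 1, y => by
    rw [lineWalk, walkHolonomy_cons, walkHolonomy_copy, walkHolonomy_lineWalk_eq_line U k n,
      dartHolonomy_add_single, ZdGaugeConfig.line]

/-- The holonomy of the tree's rectangular walk `rectWalk` is Sweep1's `ZdGaugeConfig.rectangle`.
[folklore] -/
theorem walkHolonomy_rectWalk_eq_rectangle {G : Type*} [Group G] (U : LGConfig d G)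
    (x : Literature.Probability.LatticeModels.Site d) (i j : Fin d) (R T : ℕ) :
    walkHolonomy U (rectWalk x i j R T) = ZdGaugeConfig.rectangle U x i j R T := by
  simp only [rectWalk, walkHolonomy_append, walkHolonomy_copy, walkHolonomy_reverse,
    walkHolonomy_lineWalk_eq_line, ZdGaugeConfig.rectangle, mul_assoc]

end Gauge

end Literature.MathematicalPhysics.QuantumFieldTheory
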